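import Literature.Probability.Percolation.BoundaryConnectivity
import HarnessLib

/-!
# The lattice outer boundary of a lattice-connected set is `∗`-connected (Deuschel–Pisztora; Timár)

Topic `Probability/Percolation`. Á. Timár, *Boundary-connectivity via graph theory*, Proc. AMS 141
(2013), Theorem 2 (the `ℤ^d` case is due to Deuschel–Pisztora 1996, Lemma 2.1): if `C ⊆ ℤ²` is
finite and connected in the lattice, then its outer vertex boundary visible from a far point `x₀`
(lattice neighbours of `C` joined to `x₀` by lattice walks avoiding `C`; more precisely the part
"outer visible" from `x₀`, reached by such walks with no inner vertex in the visible boundary) is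
connected in the `∗`-graph. Proof as printed: the outer-visible boundary `S` is a cutset between
`x₀` and `C`; if `S = S₁ ⊔ S₂`, take lattice walks `P_i` from `x₀` to `S_i` meeting the visible
boundary only at their ends, close them up through `C`, write the closed walk as a mod-2 sum of
unit squares (`exists_eq_xorSum_unitSq`), and count the parity of the edges between `S₂` and the
component `C_x` of `x₀` in the complement of `S`: it is odd for the walk, even for every unit
square missing `S₁`, so some unit square meets both `S₁` and `S₂`, whose corners are `∗`-adjacent.

* `LVis C x₀`, `LOutVis C x₀` — visible and outer-visible lattice boundary;
* **`exists_starWalk_latticeBoundary`** — any two outer-visible boundary sites are joined by a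
  `∗`-walk inside the outer-visible boundary.

(Companion of `exists_starWalk_starBoundary`, the `∗`/`∗` case. The mixed statement "lattice
boundary of a `∗`-connected set is `∗`-connected" is false.)

## References

* Á. Timár, Proc. Amer. Math. Soc. 141 (2013) 475–480, Lemma 1 and Theorem 2 [Timar2013].
* J.-D. Deuschel, A. Pisztora, Probab. Theory Relat. Fields 104 (1996), Lemma 2.1.
-/

noncomputable section

open SimpleGraph Finset
open scoped symmDiff
open Literature.Probability.LatticeModels (Site zdGraph zdStarGraph zdGraph_adj_iff zdStarGraph_adj
  zdGraph_le_zdStarGraph)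

namespace Literature.Probability.Percolation

/-! ### Generic walk splitting -/

section Split

variable {V : Type*} {G : SimpleGraph V}

/-- Splitting a walk at its first vertex in a set `S` (the start being outside `S`). [folklore] -/
theorem exists_split_first_mem' {S : Set V} :
    ∀ {u t : V} (W : G.Walk u t), u ∉ S → (∃ y ∈ W.support, y ∈ S) →
      ∃ (a g : V) (W₀ : G.Walk u a), G.Adj a g ∧ g ∈ S ∧ g ∈ W.support ∧
        (∀ y ∈ W₀.support, y ∉ S) ∧ (∀ y ∈ W₀.support, y ∈ W.support)
  | _, _, Walk.nil, hu, ⟨y, hy, hyS⟩ => by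
    rw [Walk.support_nil, List.mem_singleton] at hy; subst hy; exact absurd hyS hu
  | u, t, Walk.cons (v := u') hadj W', hu, hex => by
    classical
    by_cases hu' : u' ∈ S
    · exact ⟨u, u', Walk.nil, hadj, hu', by simp, fun y hy => by
        rw [Walk.support_nil, List.mem_singleton] at hy; exact hy ▸ hu, fun y hy => by
        rw [Walk.support_nil, List.mem_singleton] at hy; subst hy; simp⟩
    · have hex' : ∃ y ∈ W'.support, y ∈ S := by
        obtain ⟨y, hy, hyS⟩ := hex
        rw [Walk.support_cons, List.mem_cons] at hy
        rcases hy with rfl | hy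
        · exact absurd hyS hu
        · exact ⟨y, hy, hyS⟩
      obtain ⟨a, g, W₀, hag, hg, hgW, h1, h2⟩ := exists_split_first_mem' W' hu' hex'
      refine ⟨a, g, Walk.cons hadj W₀, hag, hg, ?_, fun y hy => ?_, fun y hy => ?_⟩
      · rw [Walk.support_cons]; exact List.mem_cons_of_mem _ hgW
      · rw [Walk.support_cons, List.mem_cons] at hy
        rcases hy with rfl | hy
        · exact hu
        · exact h1 y hy
      · rw [Walk.support_cons, List.mem_cons] at hy ⊢
        rcases hy with rfl | hy
        · exact Or.inl rfl
        · exact Or.inr (h2 y hy)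

/-- Vertices of a walk extended by one step. [folklore] -/
theorem mem_support_concat_iff' {u v w z : V} (p : G.Walk u v) (h : G.Adj v w) :
    z ∈ (p.concat h).support ↔ z ∈ p.support ∨ z = w := by
  rw [Walk.support_concat]
  simp

/-- Membership in the mod-2 edge set of a walk is the parity of the multiplicity. [folklore] -/
theorem mem_edgeParity_iff_odd_count [DecidableEq V] :
    ∀ {a b : V} (p : G.Walk a b) (e : Sym2 V), e ∈ p.edgeParity ↔ Odd (p.edges.count e)
  | _, _, Walk.nil, e => by simp [Walk.edgeParity]
  | a, _, Walk.cons (v := c) h p, e => by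
    rw [Walk.edgeParity, Finset.mem_symmDiff, Finset.mem_singleton, mem_edgeParity_iff_odd_count p e,
      Walk.edges_cons, List.count_cons]
    by_cases he : e = s(a, c)
    · subst he
      simp only [beq_self_eq_true, if_true, Nat.odd_add_one]
      tauto
    · have : (s(a, c) == e) = false := by rw [beq_eq_false_iff_ne]; exact fun h' => he h'.symm
      simp [this, he]

end Split

/-! ### Parity bookkeeping -/

section Parity

variable {α : Type*}

/-- Filtering commutes with symmetric difference. [folklore] -/
theorem filter_symmDiff' [DecidableEq α] (p : α → Prop) [DecidablePred p] (A B : Finset α) :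
    (A ∆ B).filter p = A.filter p ∆ B.filter p := by
  ext e; simp only [Finset.mem_filter, Finset.mem_symmDiff]; tauto

/-- Parity of a filtered symmetric difference. [folklore] -/
theorem odd_card_filter_symmDiff_iff [DecidableEq α] (p : α → Prop) [DecidablePred p] (A B : Finset α) :
    Odd #((A ∆ B).filter p) ↔ (Odd #(A.filter p) ↔ ¬ Odd #(B.filter p)) := by
  rw [filter_symmDiff', odd_card_symmDiff_iff]

/-- Parity of a filtered singleton. [folklore] -/
theorem odd_card_filter_singleton_iff (p : α → Prop) [DecidablePred p] (a : α) :
    Odd #(({a} : Finset α).filter p) ↔ p a := by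
  by_cases h : p a <;> simp [Finset.filter_singleton, h]

/-- In a mod-2 sum with odd filtered parity, some summand has odd filtered parity. [folklore] -/
theorem exists_odd_of_odd_xorSum {ι V : Type*} [DecidableEq ι] [DecidableEq V] (p : Sym2 V → Prop) [DecidablePred p]
    (f : ι → Finset (Sym2 V)) (s : Finset ι) (h : Odd #((xorSum f s).filter p)) :
    ∃ i ∈ s, Odd #((f i).filter p) := by
  induction s using Finset.induction_on with
  | empty => simp [xorSum_empty] at h
  | insert i s hi ih =>
    rw [xorSum_insert f hi, odd_card_filter_symmDiff_iff] at h
    by_cases h1 : Odd #((f i).filter p)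
    · exact ⟨i, Finset.mem_insert_self _ _, h1⟩
    · have h2 : Odd #((xorSum f s).filter p) := by tauto
      obtain ⟨j, hj, hj'⟩ := ih h2
      exact ⟨j, Finset.mem_insert_of_mem hj, hj'⟩

/-- The Boolean core of the unit-square parity argument: around a 4-cycle, if no vertex is of the
first kind, the second kind excludes the third kind, and consecutive vertices not of the second
kind agree on the third kind, then the number of (second, third) edges is even. [cite: Timar2013, Lemma 1 (proof)] -/
theorem square_parity_even (b c : Fin 4 → Bool) (h1 : ∀ i, c i = true → b i = false)
    (h2 : ∀ i, b i = false → b (i + 1) = false → c i = c (i + 1)) :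
    ((b 0 && c 1 || c 0 && b 1) ^^ ((b 1 && c 2 || c 1 && b 2) ^^ ((b 2 && c 3 || c 2 && b 3) ^^
      (b 3 && c 0 || c 3 && b 0)))) = false := by
  revert b c
  decide

end Parity

/-! ### Visible and outer-visible lattice boundary -/

section Boundary

variable (C : Finset (Site 2)) (x₀ : Site 2)

/-- The lattice boundary of `C` visible from `x₀`: lattice neighbours of `C` outside `C` joined to
`x₀` by a lattice walk avoiding `C`. [cite: Timar2013, §1 (∂_vis)] -/
def LVis : Set (Site 2) :=
  {y | y ∉ C ∧ (∃ c ∈ C, (zdGraph 2).Adj y c) ∧ ∃ w : (zdGraph 2).Walk x₀ y, ∀ v ∈ w.support, v ∉ C}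

/-- The outer-visible lattice boundary: visible boundary sites reached from `x₀` by a lattice walk
avoiding `C` whose other vertices are not in the visible boundary. [cite: Timar2013, §1 (∂_outvis)] -/
def LOutVis : Set (Site 2) :=
  {y | y ∈ LVis C x₀ ∧ ∃ w : (zdGraph 2).Walk x₀ y, (∀ v ∈ w.support, v ∉ C) ∧ ∀ v ∈ w.support, v ≠ y → v ∉ LVis C x₀}

variable {C x₀}

/-- A lattice walk from `x₀ ∉ C` to `C` meets the outer-visible boundary before entering `C`. [cite: Timar2013, Theorem 2 (proof: "S is a cutset")] -/
theorem exists_mem_LOutVis_of_walk (hx₀ : x₀ ∉ C) {c : Site 2} (hc : c ∈ C) (w : (zdGraph 2).Walk x₀ c) :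
    ∃ z ∈ w.support, z ∈ LOutVis C x₀ ∧ ∃ w₀ : (zdGraph 2).Walk x₀ z, (∀ v ∈ w₀.support, v ∉ C) ∧
      (∀ v ∈ w₀.support, v ≠ z → v ∉ LVis C x₀) ∧ ∀ v ∈ w₀.support, v ∈ w.support := by
  classical
  -- the first `C`-vertex and its predecessor `y ∈ LVis`
  obtain ⟨y, c', W₀, hyc', hc', -, hW₀C, hW₀w⟩ := exists_split_first_mem' (S := (↑C : Set (Site 2))) w
    (fun h => hx₀ (Finset.mem_coe.1 h)) ⟨c, Walk.end_mem_support w, Finset.mem_coe.2 hc⟩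
  have hyV : y ∈ LVis C x₀ := ⟨fun h => hW₀C y (Walk.end_mem_support W₀) (Finset.mem_coe.2 h),
    ⟨c', Finset.mem_coe.1 hc', hyc'⟩, W₀, fun v hv h => hW₀C v hv (Finset.mem_coe.2 h)⟩
  -- the first `LVis`-vertex on `W₀`
  by_cases hx₀V : x₀ ∈ LVis C x₀
  · refine ⟨x₀, Walk.start_mem_support w, ⟨hx₀V, Walk.nil, by simp [hx₀], by simp⟩, Walk.nil, by simp [hx₀], by simp, by simp⟩
  obtain ⟨p, z, W₁, hpz, hz, hzW₀, hW₁V, hW₁W₀⟩ := exists_split_first_mem' (S := LVis C x₀) W₀ hx₀V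
    ⟨y, Walk.end_mem_support W₀, hyV⟩
  have hW : ∀ v ∈ (W₁.concat hpz).support, v ∉ C := by
    intro v hv
    rw [mem_support_concat_iff'] at hv
    rcases hv with hv | rfl
    · exact fun h => hW₀C v (hW₁W₀ v hv) (Finset.mem_coe.2 h)
    · exact hz.1
  have hW' : ∀ v ∈ (W₁.concat hpz).support, v ≠ z → v ∉ LVis C x₀ := by
    intro v hv hvz
    rw [mem_support_concat_iff'] at hv
    rcases hv with hv | rfl
    · exact hW₁V v hv
    · exact absurd rfl hvz
  refine ⟨z, hW₀w z hzW₀, ⟨hz, W₁.concat hpz, hW, hW'⟩, W₁.concat hpz, hW, hW', fun v hv => ?_⟩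
  rw [mem_support_concat_iff'] at hv
  rcases hv with hv | rfl
  · exact hW₀w v (hW₁W₀ v hv)
  · exact hW₀w _ hzW₀

/-- Consecutive corners of a unit square are lattice-adjacent. [folklore] -/
theorem zdGraph_adj_corner_succ (u : Site 2) (i : Fin 4) : (zdGraph 2).Adj (corner u i) (corner u (i + 1)) := by
  rw [zdGraph_adj_iff]
  fin_cases i
  · exact ⟨0, Or.inl rfl⟩
  · exact ⟨1, Or.inl rfl⟩
  · exact ⟨0, Or.inr (by simp [corner, ex, ey, add_right_comm])⟩
  · exact ⟨1, Or.inr (by simp [corner, ey])⟩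

/-- The unit square as the mod-2 sum of its four sides. [folklore] -/
theorem unitSq_eq (u : Site 2) : unitSq u = ({s(corner u 0, corner u 1)} : Finset _) ∆ (({s(corner u 1, corner u 2)} : Finset _) ∆
    (({s(corner u 2, corner u 3)} : Finset _) ∆ (({s(corner u 3, corner u 0)} : Finset _) ∆ ∅))) := rfl

/-- A unit-square edge's endpoints are corners. [folklore] -/
theorem exists_corner_eq_of_mem_unitSq {u v : Site 2} {e : Sym2 (Site 2)} (he : e ∈ unitSq u) (hv : v ∈ e) :
    ∃ j : Fin 4, v = corner u j := by
  rcases mem_unitSq he with rfl | rfl | rfl | rfl <;> rw [Sym2.mem_iff] at hv <;> rcases hv with rfl | rfl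
  · exact ⟨0, rfl⟩
  · exact ⟨1, rfl⟩
  · exact ⟨1, rfl⟩
  · exact ⟨2, rfl⟩
  · exact ⟨2, rfl⟩
  · exact ⟨3, rfl⟩
  · exact ⟨3, rfl⟩
  · exact ⟨0, rfl⟩

/-- Odd filtered cardinality gives an element. [folklore] -/
theorem exists_of_odd_card_filter {α : Type*} {F : Finset α} {p : α → Prop} [DecidablePred p]
    (h : Odd #(F.filter p)) : ∃ e ∈ F, p e := by
  by_contra hno
  push Not at hno
  have : F.filter p = ∅ := Finset.filter_eq_empty_iff.2 fun e he => hno e he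
  rw [this] at h; simp at h

/-- The filtered parity of a unit square as a Boolean expression in its four sides. [folklore] -/
theorem odd_card_filter_unitSq_iff (u : Site 2) (p : Sym2 (Site 2) → Prop) [DecidablePred p] :
    Odd #((unitSq u).filter p) ↔
      (decide (p s(corner u 0, corner u 1)) ^^ (decide (p s(corner u 1, corner u 2)) ^^
        (decide (p s(corner u 2, corner u 3)) ^^ decide (p s(corner u 3, corner u 0))))) = true := by
  rw [unitSq_eq, odd_card_filter_symmDiff_iff, odd_card_filter_singleton_iff, odd_card_filter_symmDiff_iff,
    odd_card_filter_singleton_iff, odd_card_filter_symmDiff_iff, odd_card_filter_singleton_iff,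
    odd_card_filter_symmDiff_iff, odd_card_filter_singleton_iff]
  simp only [Finset.filter_empty, Finset.card_empty, Nat.not_odd_zero, not_false_eq_true, iff_true]
  by_cases h0 : p s(corner u 0, corner u 1) <;> by_cases h1 : p s(corner u 1, corner u 2) <;>
    by_cases h2 : p s(corner u 2, corner u 3) <;> by_cases h3 : p s(corner u 3, corner u 0) <;>
    simp [h0, h1, h2, h3]

/-- **Timár's Theorem 2 (Deuschel–Pisztora) for `ℤ²`**: the outer-visible lattice boundary of a
finite lattice-connected set is `∗`-connected. [cite: Timar2013, Theorem 2] -/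
theorem exists_starWalk_latticeBoundary
    (hC : ∀ a ∈ C, ∀ b ∈ C, ∃ q : (zdGraph 2).Walk a b, ∀ z ∈ q.support, z ∈ C)
    (hx₀C : x₀ ∉ C) (hx₀ : ∀ c ∈ C, ¬ (zdGraph 2).Adj x₀ c)
    {a b : Site 2} (ha : a ∈ LOutVis C x₀) (hb : b ∈ LOutVis C x₀) :
    ∃ q : zdStarGraph.Walk a b, ∀ z ∈ q.support, z ∈ LOutVis C x₀ := by
  classical
  by_contra hno
  -- the partition `S = S₁ ⊔ S₂`
  set S : Set (Site 2) := LOutVis C x₀ with hS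
  set S₁ : Set (Site 2) := {z | z ∈ S ∧ ∃ q : zdStarGraph.Walk a z, ∀ v ∈ q.support, v ∈ S} with hS₁
  have haS₁ : a ∈ S₁ := ⟨ha, Walk.nil, by simp [hS]; exact ha⟩
  have hbS₁ : b ∉ S₁ := fun ⟨_, q, hq⟩ => hno ⟨q, hq⟩
  have hsep : ∀ p ∈ S₁, ∀ q ∈ S, q ∉ S₁ → ¬ zdStarGraph.Adj p q := by
    rintro p ⟨hpS, wk, hwk⟩ q hqS hqS₁ hadj
    exact hqS₁ ⟨hqS, wk.concat hadj, fun v hv => by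
      rw [mem_support_concat_iff'] at hv
      rcases hv with hv | rfl
      · exact hwk v hv
      · exact hqS⟩
  -- the component `Cx` of `x₀` in the complement of `S`
  set Cx : Set (Site 2) := {v | ∃ wk : (zdGraph 2).Walk x₀ v, ∀ z ∈ wk.support, z ∉ S} with hCx
  have hx₀S : x₀ ∉ S := fun h => by
    obtain ⟨c, hc, hadj⟩ := h.1.2.1
    exact hx₀ c hc hadj
  have hCxS : ∀ v ∈ Cx, v ∉ S := fun v ⟨wk, hwk⟩ => hwk v (Walk.end_mem_support wk)
  have hCxC : ∀ v ∈ Cx, v ∉ C := by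
    rintro v ⟨wk, hwk⟩ hvC
    obtain ⟨z, hz, hzS, -⟩ := exists_mem_LOutVis_of_walk hx₀C hvC wk
    exact hwk z hz hzS
  have hCxcl : ∀ v w, v ∈ Cx → w ∉ S → (zdGraph 2).Adj v w → w ∈ Cx := by
    rintro v w ⟨wk, hwk⟩ hw hadj
    exact ⟨wk.concat hadj, fun z hz => by
      rw [mem_support_concat_iff'] at hz
      rcases hz with hz | rfl
      · exact hwk z hz
      · exact hw⟩
  -- the walks `P₁ : x₀ → a`, `P₂' : b → x₀` (a path) and the closing walk through `C`
  obtain ⟨⟨haC, ⟨c₁, hc₁, hac₁⟩, -⟩, P₁, hP₁C, hP₁V⟩ := ha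
  obtain ⟨⟨hbC, ⟨c₂, hc₂, hbc₂⟩, -⟩, P₂, hP₂C, hP₂V⟩ := hb
  set P₂' : (zdGraph 2).Walk b x₀ := P₂.reverse.bypass with hP₂'
  have hP₂'path : P₂'.IsPath := Walk.bypass_isPath _
  have hP₂'supp : ∀ v ∈ P₂'.support, v ∈ P₂.support := fun v hv => by
    have := Walk.support_bypass_subset_support _ hv
    rwa [Walk.support_reverse, List.mem_reverse] at this
  obtain ⟨Q, hQ⟩ := hC c₁ hc₁ c₂ hc₂
  -- decompose `P₂'` at its first step
  have hbx₀ : b ≠ x₀ := fun h => hx₀S (h ▸ show b ∈ S from ⟨⟨hbC, ⟨c₂, hc₂, hbc₂⟩, P₂, hP₂C⟩, P₂, hP₂C, hP₂V⟩)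
  obtain ⟨p₂, hbp₂, rest, hrest, hP₂'eq⟩ : ∃ (p₂ : Site 2) (h : (zdGraph 2).Adj b p₂) (rest : (zdGraph 2).Walk p₂ x₀),
      b ∉ rest.support ∧ P₂' = Walk.cons h rest := by
    have hpath := hP₂'path
    clear_value P₂'
    cases P₂' with
    | nil => exact absurd rfl hbx₀
    | cons h rest =>
      rw [Walk.cons_isPath_iff] at hpath
      exact ⟨_, h, rest, hpath.2, rfl⟩
  have hrestsupp : ∀ v ∈ rest.support, v ∈ P₂.support ∧ v ≠ b := fun v hv =>
    ⟨hP₂'supp v (by rw [hP₂'eq, Walk.support_cons]; exact List.mem_cons_of_mem _ hv), fun h => hrest (h ▸ hv)⟩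
  have hp₂ : p₂ ∈ rest.support := Walk.start_mem_support rest
  have hp₂b : p₂ ≠ b := (hrestsupp p₂ hp₂).2
  have hp₂V : p₂ ∉ LVis C x₀ := hP₂V p₂ (hrestsupp p₂ hp₂).1 hp₂b
  have hbS : b ∈ S := ⟨⟨hbC, ⟨c₂, hc₂, hbc₂⟩, P₂, hP₂C⟩, P₂, hP₂C, hP₂V⟩
  have hbS₂ : b ∈ S ∧ b ∉ S₁ := ⟨hbS, hbS₁⟩
  -- `p₂ ∈ Cx`: the walk `rest` from `p₂` to `x₀` avoids `S ⊆ LVis`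
  have hp₂Cx : p₂ ∈ Cx := ⟨rest.reverse, fun z hz => by
    rw [Walk.support_reverse, List.mem_reverse] at hz
    exact fun hzS => hP₂V z (hrestsupp z hz).1 (hrestsupp z hz).2 hzS.1⟩
  have hc₂Cx : c₂ ∉ Cx := fun h => hCxC c₂ h hc₂
  -- the closed walk `Z`
  set Z : (zdGraph 2).Walk x₀ x₀ := P₁.append (Walk.cons hac₁ (Q.append (Walk.cons hbc₂.symm P₂'))) with hZ
  have hZsupp : ∀ v ∈ Z.support, v ∈ P₁.support ∨ v ∈ Q.support ∨ v = b ∨ v ∈ rest.support := by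
    intro v hv
    rw [hZ, Walk.mem_support_append_iff, Walk.support_cons, List.mem_cons, Walk.mem_support_append_iff,
      Walk.support_cons, List.mem_cons, hP₂'eq, Walk.support_cons, List.mem_cons] at hv
    rcases hv with hv | rfl | hv | rfl | rfl | hv
    · exact Or.inl hv
    · exact Or.inl (Walk.end_mem_support P₁)
    · exact Or.inr (Or.inl hv)
    · exact Or.inr (Or.inl (Walk.end_mem_support Q))
    · exact Or.inr (Or.inr (Or.inl rfl))
    · exact Or.inr (Or.inr (Or.inr hv))
  -- the only vertex of `Z` in `S ∖ S₁` is `b`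
  have hZS₂ : ∀ v ∈ Z.support, v ∈ S → v ∉ S₁ → v = b := by
    intro v hv hvS hvS₁
    rcases hZsupp v hv with hv | hv | rfl | hv
    · by_contra hvb
      by_cases hva : v = a
      · exact hvS₁ (hva ▸ haS₁)
      · exact hP₁V v hv hva hvS.1
    · exact absurd (hQ v hv) hvS.1.1
    · rfl
    · exact absurd hvS.1 (hP₂V v (hrestsupp v hv).1 (hrestsupp v hv).2)
  -- the parity predicate: edges between `S₂ = S ∖ S₁` and `Cx`
  set inE₂ : Sym2 (Site 2) → Prop := fun e => ∃ p q, e = s(p, q) ∧ (p ∈ S ∧ p ∉ S₁) ∧ q ∈ Cx with hinE₂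
  -- `Z.edgeParity` has exactly one such edge: `s(b, p₂)`
  set e₀ : Sym2 (Site 2) := s(b, p₂) with he₀
  have hZedges : Z.edges = P₁.edges ++ (s(a, c₁) :: (Q.edges ++ (s(c₂, b) :: (s(b, p₂) :: rest.edges)))) := by
    rw [hZ, Walk.edges_append, Walk.edges_cons, Walk.edges_append, Walk.edges_cons, hP₂'eq, Walk.edges_cons]
  have hbP₁ : b ∉ P₁.support := fun h => by
    by_cases hba : b = a
    · exact hbS₁ (hba ▸ haS₁)
    · exact hP₁V b h hba hbS.1
  have hbQ : b ∉ Q.support := fun h => hbC (hQ b h)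
  have he₀Z : e₀ ∈ Z.edgeParity := by
    rw [mem_edgeParity_iff_odd_count, hZedges]
    have h1 : P₁.edges.count e₀ = 0 := List.count_eq_zero.2 fun h => hbP₁ (Walk.fst_mem_support_of_mem_edges _ h)
    have h2 : Q.edges.count e₀ = 0 := List.count_eq_zero.2 fun h => hbQ (Walk.fst_mem_support_of_mem_edges _ h)
    have h3 : rest.edges.count e₀ = 0 := List.count_eq_zero.2 fun h => hrest (Walk.fst_mem_support_of_mem_edges _ h)
    have h4 : (s(a, c₁) == e₀) = false := by
      rw [beq_eq_false_iff_ne]; intro h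
      have : b ∈ s(a, c₁) := by rw [h, he₀]; exact Sym2.mem_mk_left _ _
      rcases Sym2.mem_iff.1 this with rfl | rfl
      · exact hbS₁ haS₁
      · exact hbC hc₁
    have h5 : (s(c₂, b) == e₀) = false := by
      rw [beq_eq_false_iff_ne, he₀]; intro h
      have : c₂ = p₂ := by
        have hm : c₂ ∈ s(b, p₂) := by rw [← h]; exact Sym2.mem_mk_left _ _
        rcases Sym2.mem_iff.1 hm with h' | h'
        · exact absurd h' (fun h'' => hbC (h'' ▸ hc₂))
        · exact h'
      exact hc₂Cx (this ▸ hp₂Cx)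
    have hcount : (P₁.edges ++ (s(a, c₁) :: (Q.edges ++ (s(c₂, b) :: (s(b, p₂) :: rest.edges))))).count e₀ = 1 := by
      simp only [List.count_append, List.count_cons, h1, h2, h3, h4, h5]
      simp [he₀]
    rw [hcount]; exact odd_one
  have hfilter : Z.edgeParity.filter inE₂ = {e₀} := by
    ext e
    rw [Finset.mem_filter, Finset.mem_singleton]
    constructor
    · rintro ⟨he, p, q, rfl, ⟨hpS, hpS₁⟩, hqCx⟩
      have hedge := mem_edges_of_mem_edgeParity Z he
      have hpZ : p ∈ Z.support := Walk.fst_mem_support_of_mem_edges _ hedge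
      have hpb : p = b := hZS₂ p hpZ hpS hpS₁
      subst hpb
      rw [hZedges] at hedge
      simp only [List.mem_append, List.mem_cons] at hedge
      rcases hedge with h | h | h | h | h | h
      · exact absurd (Walk.fst_mem_support_of_mem_edges _ h) hbP₁
      · exfalso
        have : p ∈ s(a, c₁) := by rw [← h]; exact Sym2.mem_mk_left _ _
        rcases Sym2.mem_iff.1 this with rfl | rfl
        · exact hbS₁ haS₁
        · exact hbC hc₁
      · exact absurd (Walk.fst_mem_support_of_mem_edges _ h) hbQ
      · exfalso
        have hq : q ∈ s(c₂, p) := by rw [← h]; exact Sym2.mem_mk_right _ _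
        rcases Sym2.mem_iff.1 hq with rfl | rfl
        · exact hc₂Cx hqCx
        · exact hCxS q hqCx hpS
      · exact h
      · exact absurd (Walk.fst_mem_support_of_mem_edges _ h) hrest
    · rintro rfl
      exact ⟨he₀Z, b, p₂, rfl, hbS₂, hp₂Cx⟩
  have hodd : Odd #(Z.edgeParity.filter inE₂) := by rw [hfilter]; simp
  -- decompose into unit squares
  have hEul : IsEulerian Z.edgeParity := fun v h => by
    rw [oddDeg_edgeParity_iff] at h; exact h.1 rfl
  obtain ⟨𝒮, h𝒮⟩ := exists_eq_xorSum_unitSq Z.edgeParity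
    (fun e he => Walk.edges_subset_edgeSet _ (mem_edges_of_mem_edgeParity Z he)) hEul
  rw [h𝒮] at hodd
  obtain ⟨u, -, hu⟩ := exists_odd_of_odd_xorSum inE₂ unitSq 𝒮 hodd
  -- analysis of the unit square `u`
  have hside : ∀ i j : Fin 4, inE₂ s(corner u i, corner u j) ↔
      ((corner u i ∈ S ∧ corner u i ∉ S₁) ∧ corner u j ∈ Cx) ∨
        (corner u i ∈ Cx ∧ (corner u j ∈ S ∧ corner u j ∉ S₁)) := by
    intro i j
    constructor
    · rintro ⟨p, q, h, hp, hq⟩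
      rcases Sym2.eq_iff.1 h with ⟨h1, h2⟩ | ⟨h1, h2⟩
      · exact Or.inl ⟨h1 ▸ hp, h2 ▸ hq⟩
      · exact Or.inr ⟨h1 ▸ hq, h2 ▸ hp⟩
    · rintro (⟨hp, hq⟩ | ⟨hq, hp⟩)
      · exact ⟨_, _, rfl, hp, hq⟩
      · exact ⟨_, _, Sym2.eq_swap, hp, hq⟩
  -- some corner is in `S₂`; if some corner is in `S₁` we get adjacent `S₁`, `S₂` sites
  obtain ⟨e, he, pe, qe, rfl, ⟨hpeS, hpeS₁⟩, hqe⟩ := exists_of_odd_card_filter hu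
  obtain ⟨j, rfl⟩ := exists_corner_eq_of_mem_unitSq he (Sym2.mem_mk_left _ _)
  by_cases hS₁c : ∃ i, corner u i ∈ S₁
  · obtain ⟨i, hi⟩ := hS₁c
    rcases corner_adj_or_eq u i j with h | h
    · exact hpeS₁ (h ▸ hi)
    · exact hsep _ hi _ hpeS hpeS₁ h
  · push Not at hS₁c
    set bb : Fin 4 → Bool := fun i => decide (corner u i ∈ S ∧ corner u i ∉ S₁) with hbb
    set cc : Fin 4 → Bool := fun i => decide (corner u i ∈ Cx) with hcc
    have h1 : ∀ i, cc i = true → bb i = false := fun i h => by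
      simp only [hcc, decide_eq_true_eq] at h
      simp only [hbb, decide_eq_false_iff_not, not_and]
      exact fun hS' => absurd hS' (hCxS _ h)
    have h2 : ∀ i, bb i = false → bb (i + 1) = false → cc i = cc (i + 1) := by
      intro i hi hi'
      simp only [hbb, decide_eq_false_iff_not, not_and, not_not] at hi hi'
      have hiS : corner u i ∉ S := fun h => hS₁c i (hi h)
      have hi'S : corner u (i + 1) ∉ S := fun h => hS₁c (i + 1) (hi' h)
      simp only [hcc]
      rw [Bool.eq_iff_iff, decide_eq_true_eq, decide_eq_true_eq]
      exact ⟨fun h => hCxcl _ _ h hi'S (zdGraph_adj_corner_succ u i),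
        fun h => hCxcl _ _ h hiS (zdGraph_adj_corner_succ u i).symm⟩
    have hcore := square_parity_even bb cc h1 h2
    have hiff : ∀ i j : Fin 4, decide (inE₂ s(corner u i, corner u j)) = (bb i && cc j || cc i && bb j) := by
      intro i j
      rw [Bool.eq_iff_iff, decide_eq_true_eq, hside i j]
      simp only [hbb, hcc, Bool.or_eq_true, Bool.and_eq_true, decide_eq_true_eq]
    rw [odd_card_filter_unitSq_iff, hiff 0 1, hiff 1 2, hiff 2 3, hiff 3 0] at hu
    rw [hcore] at hu
    exact Bool.false_ne_true hu

end Boundary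

end Literature.Probability.Percolation
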